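import Summits.Ventures.CertifiedManyBodySolver.Theorems.M3x2EdgeSplitSymReplayOutRouteEta
import HarnessLib

/-!
# SymReplay checker — WORD-LEVEL FACTOR ROWS («η»), part 2: the bilinear regrouping (`hsem`), word inclusion (`hW`), and the
closing through the tree's SEMANTIC skeleton `…OutRouteHSem`

(team lb-sym, cell hub-lb.  SPEC TEXT by the pen hub-lb-sym-plan-1 g5 — crux workfile
`Cruxes/LowerEdge_ge_m83o100/EtaSpec_symplan1.lean` pass 3, sha16 7ce6972eff7990e9, sections (b4) and (c) VERBATIM (`tagRep_row`
polymorphic in the row payload, as part 1); landed by the adopting engine hub-lb-sym-eng-3 g4.  ADDITIVE on part 1 `…OutRouteEta`,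
`…OutRouteMF` / `…OutRoutePF` (hub-lb-sym-eng-4) and `…OutRouteHSem` (hub-lb-sym-eng-3 g3); nothing landed is touched.)

CONTENTS.  (b4) **`enum_sum_eq_theta`** — with ascending rows of width `≤ n` the double sum `Σ_y Σ_x (⟨L_y,L_x⟩ c_y c_x) • Φ u_y w_x`
depends on the tagged lists only through their word fibers `wmu` (column expansion `sdot_eq_sum` + `sum_smul_fiber`); `shareRWithMF`
as a bucketed enumeration over `tagRep` (`shareRWithMF_eq_enum`); **`polyOp_shareRWithMFη`** / **`polyOp_shareRFastMFη`**: `polyOp Λ'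
(η share) = polyOp Λ' (MF share)` for every window `Λ'` (rows ascending) — the `hsem` obligation.  (c) **`words_enumη`** /
**`words_shareRFastMFη`**: every word the η share emits is emitted by the MF share (from `⟨ρ_u, σ_w⟩ ≠ 0` a pair `(i ∋ u, j ∋ w)` with
`⟨L_i, L_j⟩ ≠ 0` is extracted, `sdot_drow_drow`) — the `hW` obligation; and the closing **`energyDensity_ge_of_outroutePMFη0`**: bare
packed facts over `J·L` modules on `m ↦ shareRFastMFη Sm K (K.gramR.map genBasis) hm κ₂ J L (m / L) (m % L)`, hypotheses = `…PMF0`'s +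
the `decide`-able side fact `hAsc : (K.gramR.all fun B => B.rows.all rowAsc) = true` (`gramBlockROK` does not check `rowAsc`; under
grammar v2 it is dischargeable by `decodeGramRV2_sorted`, hub-lb-sym-ref-2 g2), THROUGH THE TREE's `energyDensity_ge_of_outroutePSem0`
(`hW` ↦ `words_shareRFastMFη` + `shareRFastMF_perm_lin`; `hsem` ↦ `polyOp_shareRFastMFη` + `polyOp_perm`).  The tree's abstract identity
`EtaAlgebra.eta_regroup` (p665768) is the `Fintype` form of `enum_sum_eq_theta` ∘ `sum_smul_fiber`; this file proves the list-level
instance directly.  Module grammar: per module `m < J·L` one file `out_m : PackedNF.pisZero (PackedNF.pcanonNFZHBZ lo hi oP (PackedNF.encP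
lo hi (<η share> … (m / L) (m % L)))) = true := by native_decide` on an ENGINE share that is LIST-EQUAL to `shareRFastMFη`
(`…OutRouteEtaA`: `shareRFastMFηA_eq`; `…OutRouteEtaD`: dense integer rows) — standard axioms here; no `native_decide` in this file.

HONEST FRAMING: an enumeration COST lever and its soundness plumbing; no certificate lands by this file; no bound of record
moves (#529 = −0.8295699476 stays outside Lean; tree floor −0.8942613047 computational); `LowerEdge_ge_m83o100` stays met BY
VALUE only; no summit or crux statement is proved here; nothing here predicts superconductivity.
-/

namespace Summit.Ventures.CertifiedManyBodySolver.Theorems.SymReplay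

open Literature.MathematicalPhysics.QuantumLattice
open Literature.MathematicalPhysics.QuantumLattice.HubbardWave0
open Literature.MathematicalPhysics.QuantumLattice.ThermodynamicLimit
open Literature.Probability.LatticeModels
open Literature.MathematicalPhysics.QuantumManyBody.StateRelaxation
open Summit.Ventures.CertifiedManyBodySolver.Theorems.WardSlot

section Eta

variable {M : Type} [DecidableEq M] [Hashable M]

/-! ###### (b4) the bilinear expansion and the regrouping identity -/

omit [DecidableEq M] [Hashable M] in
/-- **Bilinear expansion**: with ascending rows of width `≤ n`, the double sum depends on the lists only through their word
fibers `wmu`. -/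
theorem enum_sum_eq_theta [DecidableEq Word] (Λ' : Finset (Site 2)) (L₁ L₂ : List (List (ℚ × ℕ) × (ℚ × Word))) (n : ℕ)
    (h₁ : ∀ y ∈ L₁, rowAsc y.1 = true ∧ ∀ e ∈ y.1, e.2 < n) (h₂ : ∀ x ∈ L₂, rowAsc x.1 = true ∧ ∀ e ∈ x.1, e.2 < n)
    (V W : Finset Word) (hV : ∀ y ∈ L₁, y.2.2 ∈ V) (hW : ∀ x ∈ L₂, x.2.2 ∈ W) (Φ : Word → Word → FermionOp Λ') :
    (L₁.map fun y => (L₂.map fun x => ((sdot y.1 x.1 * (y.2.1 * x.2.1) : ℚ) : ℂ) • Φ y.2.2 x.2.2).sum).sum =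
      ∑ k ∈ Finset.range n, ∑ v ∈ V, ∑ w ∈ W, ((wmu L₁ v k * wmu L₂ w k : ℚ) : ℂ) • Φ v w := by
  have hsd : ∀ y ∈ L₁, ∀ x ∈ L₂, sdot y.1 x.1 * (y.2.1 * x.2.1) =
      ∑ k ∈ Finset.range n, (y.2.1 * rowCoef y.1 k) * (x.2.1 * rowCoef x.1 k) := by
    intro y hy x hx
    rw [sdot_eq_sum n y.1 x.1 (h₁ y hy).1 (h₂ x hx).1 (h₁ y hy).2 (h₂ x hx).2,
      Fin.sum_univ_eq_sum_range (fun k => rowCoef y.1 k * rowCoef x.1 k) n, Finset.sum_mul]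
    exact Finset.sum_congr rfl fun k _ => by ring
  have e1 : (L₁.map fun y => (L₂.map fun x => ((sdot y.1 x.1 * (y.2.1 * x.2.1) : ℚ) : ℂ) • Φ y.2.2 x.2.2).sum).sum =
      (L₁.map fun y => (L₂.map fun x => ∑ k ∈ Finset.range n,
        (((y.2.1 * rowCoef y.1 k) * (x.2.1 * rowCoef x.1 k) : ℚ) : ℂ) • Φ y.2.2 x.2.2).sum).sum := by
    refine congrArg List.sum (List.map_congr_left fun y hy => congrArg List.sum (List.map_congr_left fun x hx => ?_))
    rw [hsd y hy x hx, Rat.cast_sum, Finset.sum_smul]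
  rw [e1]
  simp only [list_sum_map_finset_sum]
  refine Finset.sum_congr rfl fun k _ => ?_
  have e2 : (L₁.map fun y => (L₂.map fun x =>
      (((y.2.1 * rowCoef y.1 k) * (x.2.1 * rowCoef x.1 k) : ℚ) : ℂ) • Φ y.2.2 x.2.2).sum).sum =
      (L₁.map fun y => (((y.2.1 * rowCoef y.1 k) : ℚ) : ℂ) •
        (L₂.map fun x => (((x.2.1 * rowCoef x.1 k) : ℚ) : ℂ) • Φ y.2.2 x.2.2).sum).sum := by
    refine congrArg List.sum (List.map_congr_left fun y _ => ?_)
    rw [List.smul_sum, List.map_map]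
    refine congrArg List.sum (List.map_congr_left fun x _ => ?_)
    simp only [Function.comp_def, Rat.cast_mul, mul_smul]
  rw [e2, sum_smul_fiber Λ' L₁ (fun y => y.2.2) (fun y => y.2.1 * rowCoef y.1 k)
    (fun v => (L₂.map fun x => (((x.2.1 * rowCoef x.1 k) : ℚ) : ℂ) • Φ v x.2.2).sum) V hV]
  refine Finset.sum_congr rfl fun v _ => ?_
  rw [sum_smul_fiber Λ' L₂ (fun x => x.2.2) (fun x => x.2.1 * rowCoef x.1 k) (fun w => Φ v w) W hW, Finset.smul_sum]
  refine Finset.sum_congr rfl fun w _ => ?_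
  rw [smul_smul, ← Rat.cast_mul]
  rfl

/-- `rowFastF` is `rowFastFη` over the tagged representative terms (the dot only reads the row). -/
theorem rowFastF_eq_tagRep (S : MomSpec M) (a : QPoly × List (ℚ × ℕ))
    (wmap : Std.HashMap M (List (List (ℚ × ℕ) × (ℚ × Word)))) (m s : ℚ) (T : List M) (P₂ : Word → Bool) :
    rowFastF S a wmap m s T P₂ = ((padj a.1).map fun t => (a.2, t)).flatMap fun y => rowFastFη S y wmap m s T P₂ := by
  rw [flatMap_map']; rfl

/-- `shareRWithMF` as a bucketed enumeration over `tagRep`. -/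
theorem shareRWithMF_eq_enum (S : MomSpec M) (K : SymCertR) (gbs : List (List QPoly)) (T : List M) (P₂ : Word → Bool) :
    shareRWithMF S K gbs T P₂ = (K.gramR.zip gbs).flatMap fun Bg =>
      (tagRep (Bg.1.reps.zip Bg.1.rows)).flatMap fun y =>
        rowFastFη S y (bucketOf S (wflat (Bg.2.zip Bg.1.rows))) Bg.1.moves.length Bg.1.scale T P₂ := by
  rw [shareRWithMF]
  congr 1
  funext Bg
  dsimp only
  rw [tagRep, flatMap_flatMap']
  congr 1
  funext a
  exact rowFastF_eq_tagRep S a _ _ _ T P₂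

omit [Hashable M] in
/-- Rows of tagged representative / basis terms are block rows. -/
theorem tagRep_row {ρ : Type} {ra : List (QPoly × ρ)} {y : ρ × (ℚ × Word)} (h : y ∈ tagRep ra) :
    ∃ a ∈ ra, y.1 = a.2 ∧ y.2 ∈ padj a.1 := by
  rw [tagRep, List.mem_flatMap] at h
  obtain ⟨a, ha, h⟩ := h
  rw [List.mem_map] at h
  obtain ⟨t, ht, rfl⟩ := h
  exact ⟨a, ha, rfl, ht⟩

omit [DecidableEq M] [Hashable M] in
/-- Rows of tagged basis terms are block rows. -/
theorem wflat_row {qr : List (QPoly × List (ℚ × ℕ))} {x : List (ℚ × ℕ) × (ℚ × Word)} (h : x ∈ wflat qr) :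
    ∃ b ∈ qr, x.1 = b.2 ∧ x.2 ∈ b.1 := by
  rw [wflat, List.mem_flatMap] at h
  obtain ⟨b, hb, h⟩ := h
  rw [List.mem_map] at h
  obtain ⟨t, ht, rfl⟩ := h
  exact ⟨b, hb, rfl, ht⟩

/-- **The regrouping identity** (rows ascending): `polyOp Λ' (shareRWithMFη …) = polyOp Λ' (shareRWithMF …)`. -/
theorem polyOp_shareRWithMFη (S : MomSpec M) (K : SymCertR) (gbs : List (List QPoly)) (T : List M) (P₂ : Word → Bool)
    (hAsc : ∀ B ∈ K.gramR, ∀ r ∈ B.rows, rowAsc r = true) (Λ' : Finset (Site 2)) :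
    polyOp Λ' (shareRWithMFη S K gbs T P₂) = polyOp Λ' (shareRWithMF S K gbs T P₂) := by
  classical
  rw [shareRWithMF_eq_enum, shareRWithMFη, polyOp_flatMap, polyOp_flatMap]
  refine congrArg List.sum (List.map_congr_left fun Bg hBg => ?_)
  have hB : Bg.1 ∈ K.gramR := (List.of_mem_zip hBg).1
  dsimp only
  rw [polyOp_enum_eq, polyOp_enum_eq]
  -- row facts: block rows are ascending with columns below `colBound`
  have hrow : ∀ r ∈ Bg.1.rows, rowAsc r = true ∧ ∀ e ∈ r, e.2 < colBound (toGramBlock Bg.1) := fun r hr =>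
    ⟨hAsc _ hB r hr, fun e he => lt_colBound (toGramBlock Bg.1) hr he⟩
  have hRT : ∀ y ∈ tagRep (Bg.1.reps.zip Bg.1.rows), rowAsc y.1 = true ∧ ∀ e ∈ y.1, e.2 < colBound (toGramBlock Bg.1) :=
    fun y hy => by
      obtain ⟨a, ha, h1, -⟩ := tagRep_row hy
      rw [h1]; exact hrow _ (List.of_mem_zip ha).2
  have hWT : ∀ x ∈ wflat (Bg.2.zip Bg.1.rows), rowAsc x.1 = true ∧ ∀ e ∈ x.1, e.2 < colBound (toGramBlock Bg.1) :=
    fun x hx => by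
      obtain ⟨b, hb, h1, -⟩ := wflat_row hx
      rw [h1]; exact hrow _ (List.of_mem_zip hb).2
  -- common word supersets
  let V : Finset Word := ((tagRep (Bg.1.reps.zip Bg.1.rows)).map fun y => y.2.2).toFinset ∪
    ((dgroup (colBound (toGramBlock Bg.1)) (tagRep (Bg.1.reps.zip Bg.1.rows))).map fun y => y.2.2).toFinset
  let W : Finset Word := ((wflat (Bg.2.zip Bg.1.rows)).map fun x => x.2.2).toFinset ∪
    ((dgroup (colBound (toGramBlock Bg.1)) (wflat (Bg.2.zip Bg.1.rows))).map fun x => x.2.2).toFinset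
  have hV₁ : ∀ y ∈ tagRep (Bg.1.reps.zip Bg.1.rows), y.2.2 ∈ V := fun y hy =>
    Finset.mem_union_left _ (List.mem_toFinset.2 (List.mem_map.2 ⟨y, hy, rfl⟩))
  have hV₂ : ∀ y ∈ dgroup (colBound (toGramBlock Bg.1)) (tagRep (Bg.1.reps.zip Bg.1.rows)), y.2.2 ∈ V := fun y hy =>
    Finset.mem_union_right _ (List.mem_toFinset.2 (List.mem_map.2 ⟨y, hy, rfl⟩))
  have hW₁ : ∀ x ∈ wflat (Bg.2.zip Bg.1.rows), x.2.2 ∈ W := fun x hx =>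
    Finset.mem_union_left _ (List.mem_toFinset.2 (List.mem_map.2 ⟨x, hx, rfl⟩))
  have hW₂ : ∀ x ∈ dgroup (colBound (toGramBlock Bg.1)) (wflat (Bg.2.zip Bg.1.rows)), x.2.2 ∈ W := fun x hx =>
    Finset.mem_union_right _ (List.mem_toFinset.2 (List.mem_map.2 ⟨x, hx, rfl⟩))
  rw [enum_sum_eq_theta Λ' _ _ _ dgroup_rows dgroup_rows V W hV₂ hW₂,
    enum_sum_eq_theta Λ' _ _ _ hRT hWT V W hV₁ hW₁]
  refine Finset.sum_congr rfl fun k hk => Finset.sum_congr rfl fun v _ => Finset.sum_congr rfl fun w _ => ?_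
  rw [wmu_dgroup _ _ v (Finset.mem_range.1 hk), wmu_dgroup _ _ w (Finset.mem_range.1 hk)]

/-- The sub-module share by word-level rows has the operator value of `shareRFastMF`'s. -/
theorem polyOp_shareRFastMFη (S : MomSpec M) (K : SymCertR) (gbs : List (List QPoly)) (hm : MomTable M) (κ₂ : Word → ℕ)
    (J L i f : ℕ) (hAsc : ∀ B ∈ K.gramR, ∀ r ∈ B.rows, rowAsc r = true) (Λ' : Finset (Site 2)) :
    polyOp Λ' (shareRFastMFη S K gbs hm κ₂ J L i f) = polyOp Λ' (shareRFastMF S K gbs hm κ₂ J L i f) := by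
  simp only [shareRFastMFη, shareRFastMF, polyOp_append, polyOp_shareRWithMFη S K gbs _ _ hAsc]

/-! ##### (c) Word inclusion (`hW`) and the closing over `J·L` modules through the tree's semantic skeleton -/

/-- Rows-ascending side fact, unpacked. -/
theorem rowsAsc_of_all (K : SymCertR) (hAsc : (K.gramR.all fun B => B.rows.all rowAsc) = true) :
    ∀ B ∈ K.gramR, ∀ r ∈ B.rows, rowAsc r = true := by
  intro B hB r hr
  have h := List.all_eq_true.1 hAsc B hB
  exact List.all_eq_true.1 h r hr

omit [DecidableEq M] [Hashable M] in
/-- A nonzero list sum has a nonzero summand. -/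
theorem exists_ne_zero_of_list_sum_ne_zero {α N : Type*} [AddMonoid N] (l : List α) (f : α → N)
    (h : (l.map f).sum ≠ 0) : ∃ a ∈ l, f a ≠ 0 := by
  by_contra hc
  push Not at hc
  exact h (List.sum_eq_zero fun q hq => by
    obtain ⟨a, ha, rfl⟩ := List.mem_map.1 hq
    exact hc a ha)

omit [DecidableEq M] [Hashable M] in
/-- Product of two list sums as a double list sum. -/
theorem list_sum_mul_list_sum {α β : Type*} (l₁ : List α) (l₂ : List β) (f : α → ℚ) (g : β → ℚ) :
    (l₁.map f).sum * (l₂.map g).sum = (l₁.map fun a => (l₂.map fun b => f a * g b).sum).sum := by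
  rw [← List.sum_map_mul_right]
  exact congrArg List.sum (List.map_congr_left fun a _ => by rw [List.sum_map_mul_left])

omit [DecidableEq M] [Hashable M] in
/-- **The dot of two word-level rows, expanded over their groups**: `⟨ρ_ch, ρ_ch'⟩ = Σ_{y ∈ ch} Σ_{x ∈ ch'} c_y c_x ⟨L_y, L_x⟩`. -/
theorem sdot_drow_drow (n : ℕ) (ch ch' : List (List (ℚ × ℕ) × (ℚ × Word)))
    (h₁ : ∀ y ∈ ch, rowAsc y.1 = true ∧ ∀ e ∈ y.1, e.2 < n) (h₂ : ∀ x ∈ ch', rowAsc x.1 = true ∧ ∀ e ∈ x.1, e.2 < n) :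
    sdot (drow n ch) (drow n ch') = (ch.map fun y => (ch'.map fun x => y.2.1 * x.2.1 * sdot y.1 x.1).sum).sum := by
  rw [sdot_eq_sum n _ _ (rowAsc_drow n ch) (rowAsc_drow n ch') (drow_bound n ch) (drow_bound n ch'),
    Fin.sum_univ_eq_sum_range (fun k => rowCoef (drow n ch) k * rowCoef (drow n ch') k) n]
  have e1 : (ch.map fun y => (ch'.map fun x => y.2.1 * x.2.1 * sdot y.1 x.1).sum).sum =
      (ch.map fun y => (ch'.map fun x =>
        ∑ k ∈ Finset.range n, (y.2.1 * rowCoef y.1 k) * (x.2.1 * rowCoef x.1 k)).sum).sum := by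
    refine congrArg List.sum (List.map_congr_left fun y hy => congrArg List.sum (List.map_congr_left fun x hx => ?_))
    rw [sdot_eq_sum n y.1 x.1 (h₁ y hy).1 (h₂ x hx).1 (h₁ y hy).2 (h₂ x hx).2,
      Fin.sum_univ_eq_sum_range (fun k => rowCoef y.1 k * rowCoef x.1 k) n, Finset.mul_sum]
    exact Finset.sum_congr rfl fun k _ => by ring
  rw [e1]
  simp only [list_sum_map_finset_sum]
  refine Finset.sum_congr rfl fun k hk => ?_
  rw [rowCoef_drow n ch (Finset.mem_range.1 hk), rowCoef_drow n ch' (Finset.mem_range.1 hk), list_sum_mul_list_sum]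

/-- **Word inclusion, block level**: every word emitted by the η enumeration of a block is emitted by the MF enumeration of
the same block — from `⟨ρ_u, σ_w⟩ ≠ 0` extract a pair `(i ∋ u, j ∋ w)` with `⟨L_i, L_j⟩ ≠ 0` (`sdot_drow_drow` + a nonzero
summand), whose MF product hit emits `u ++ w`. -/
theorem words_enumη (S : MomSpec M) (L₁ L₂ : List (List (ℚ × ℕ) × (ℚ × Word))) (n : ℕ)
    (h₁ : ∀ y ∈ L₁, rowAsc y.1 = true ∧ ∀ e ∈ y.1, e.2 < n) (h₂ : ∀ x ∈ L₂, rowAsc x.1 = true ∧ ∀ e ∈ x.1, e.2 < n)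
    (m s : ℚ) (T : List M) (P₂ : Word → Bool) :
    ∀ t ∈ (dgroup n L₁).flatMap (fun y => rowFastFη S y (bucketOf S (dgroup n L₂)) m s T P₂),
      ∃ t' ∈ L₁.flatMap (fun y => rowFastFη S y (bucketOf S L₂) m s T P₂), t'.2 = t.2 := by
  intro t ht
  rw [List.mem_flatMap] at ht
  obtain ⟨y, hy, ht⟩ := ht
  rw [rowFastFη, List.mem_flatMap] at ht
  obtain ⟨mt, hmt, ht⟩ := ht
  rw [List.mem_filterMap] at ht
  obtain ⟨x, hx, hxt⟩ := ht
  rw [bucketOf_getD, List.mem_reverse, List.mem_filter, decide_eq_true_eq] at hx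
  obtain ⟨hx, hmom⟩ := hx
  simp only [stepOpt] at hxt
  split_ifs at hxt with hP h0
  simp only [Option.some.injEq] at hxt
  -- the groups behind `y` and `x`; their words are constant
  obtain ⟨ch, hch, hy1, y₁, hy₁, -, hy2⟩ := mem_dgroup hy
  obtain ⟨ch', hch', hx1, x₁, hx₁, -, hx2⟩ := mem_dgroup hx
  have hchw : ∀ y₀ ∈ ch, y₀.2.2 = y.2.2 := fun y₀ hy₀ => by
    rw [hy2]; exact (wgroup_spec L₁ ch hch).2 y₀ hy₀ y₁ hy₁
  have hchw' : ∀ x₀ ∈ ch', x₀.2.2 = x.2.2 := fun x₀ hx₀ => by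
    rw [hx2]; exact (wgroup_spec L₂ ch' hch').2 x₀ hx₀ x₁ hx₁
  have hrows : ∀ y₀ ∈ ch, rowAsc y₀.1 = true ∧ ∀ e ∈ y₀.1, e.2 < n := fun y₀ hy₀ => h₁ y₀ (mem_of_mem_wgroup hch hy₀)
  have hrows' : ∀ x₀ ∈ ch', rowAsc x₀.1 = true ∧ ∀ e ∈ x₀.1, e.2 < n := fun x₀ hx₀ =>
    h₂ x₀ (mem_of_mem_wgroup hch' hx₀)
  -- witness extraction
  rw [hy1, hx1, sdot_drow_drow n ch ch' hrows hrows'] at h0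
  obtain ⟨y₀, hy₀, h0⟩ := exists_ne_zero_of_list_sum_ne_zero _ _ h0
  obtain ⟨x₀, hx₀, h0⟩ := exists_ne_zero_of_list_sum_ne_zero _ _ h0
  have hd : sdot y₀.1 x₀.1 ≠ 0 := by
    intro h
    refine h0 ?_
    rw [h, mul_zero]
  have hP' : P₂ (y₀.2.2 ++ x₀.2.2) = true := by rw [hchw y₀ hy₀, hchw' x₀ hx₀]; exact hP
  -- the MF term of the pair `(y₀, x₀)`
  refine ⟨(-1 * (m * (s * sdot y₀.1 x₀.1)) * (y₀.2.1 * x₀.2.1), y₀.2.2 ++ x₀.2.2), ?_, ?_⟩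
  · rw [List.mem_flatMap]
    refine ⟨y₀, mem_of_mem_wgroup hch hy₀, ?_⟩
    rw [rowFastFη, List.mem_flatMap]
    refine ⟨mt, hmt, ?_⟩
    rw [List.mem_filterMap]
    refine ⟨x₀, ?_, ?_⟩
    · rw [bucketOf_getD, List.mem_reverse, List.mem_filter, decide_eq_true_eq]
      exact ⟨mem_of_mem_wgroup hch' hx₀, by rw [hchw' x₀ hx₀, hchw y₀ hy₀]; exact hmom⟩
    · rw [if_pos hP']
      simp only [stepOpt]
      rw [if_neg hd]
  · rw [← hxt]
    show y₀.2.2 ++ x₀.2.2 = y.2.2 ++ x.2.2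
    rw [hchw y₀ hy₀, hchw' x₀ hx₀]

/-- Block rows behind the tagged representative terms: ascending, columns `< colBound`. -/
theorem tagRep_rows {K : SymCertR} (hAsc : ∀ B ∈ K.gramR, ∀ r ∈ B.rows, rowAsc r = true) {B : GramBlockR}
    (hB : B ∈ K.gramR) :
    ∀ y ∈ tagRep (B.reps.zip B.rows), rowAsc y.1 = true ∧ ∀ e ∈ y.1, e.2 < colBound (toGramBlock B) := fun y hy => by
  obtain ⟨a, ha, h1, -⟩ := tagRep_row hy
  rw [h1]
  exact ⟨hAsc _ hB _ (List.of_mem_zip ha).2, fun e he => lt_colBound (toGramBlock B) (List.of_mem_zip ha).2 he⟩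

omit [DecidableEq M] [Hashable M] in
/-- Block rows behind the tagged basis terms: ascending, columns `< colBound`. -/
theorem wflat_rows {K : SymCertR} (hAsc : ∀ B ∈ K.gramR, ∀ r ∈ B.rows, rowAsc r = true) {B : GramBlockR}
    (hB : B ∈ K.gramR) (qs : List QPoly) :
    ∀ x ∈ wflat (qs.zip B.rows), rowAsc x.1 = true ∧ ∀ e ∈ x.1, e.2 < colBound (toGramBlock B) := fun x hx => by
  obtain ⟨b, hb, h1, -⟩ := wflat_row hx
  rw [h1]
  exact ⟨hAsc _ hB _ (List.of_mem_zip hb).2, fun e he => lt_colBound (toGramBlock B) (List.of_mem_zip hb).2 he⟩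

/-- **Word inclusion for the R-part** (rows ascending). -/
theorem words_shareRWithMFη (S : MomSpec M) (K : SymCertR) (gbs : List (List QPoly)) (T : List M) (P₂ : Word → Bool)
    (hAsc : ∀ B ∈ K.gramR, ∀ r ∈ B.rows, rowAsc r = true) :
    ∀ t ∈ shareRWithMFη S K gbs T P₂, ∃ t' ∈ shareRWithMF S K gbs T P₂, t'.2 = t.2 := by
  intro t ht
  rw [shareRWithMFη, List.mem_flatMap] at ht
  obtain ⟨Bg, hBg, ht⟩ := ht
  dsimp only at ht
  have hB : Bg.1 ∈ K.gramR := (List.of_mem_zip hBg).1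
  obtain ⟨t', ht', he⟩ :=
    words_enumη S _ _ _ (tagRep_rows hAsc hB) (wflat_rows hAsc hB Bg.2) _ _ T P₂ t ht
  refine ⟨t', ?_, he⟩
  rw [shareRWithMF_eq_enum, List.mem_flatMap]
  exact ⟨Bg, hBg, ht'⟩

/-- **Word inclusion for the sub-module share**: every word of `shareRFastMFη … i f` is a word of `shareRFastMF … i f`. -/
theorem words_shareRFastMFη (S : MomSpec M) (K : SymCertR) (gbs : List (List QPoly)) (hm : MomTable M) (κ₂ : Word → ℕ)
    (J L i f : ℕ) (hAsc : ∀ B ∈ K.gramR, ∀ r ∈ B.rows, rowAsc r = true) :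
    ∀ t ∈ shareRFastMFη S K gbs hm κ₂ J L i f, ∃ t' ∈ shareRFastMF S K gbs hm κ₂ J L i f, t'.2 = t.2 := by
  intro t ht
  simp only [shareRFastMFη, List.mem_append] at ht
  rcases ht with ht | ht | ht
  · exact ⟨t, by simp only [shareRFastMF, List.mem_append]; exact Or.inl ht, rfl⟩
  · exact ⟨t, by simp only [shareRFastMF, List.mem_append]; exact Or.inr (Or.inl ht), rfl⟩
  · obtain ⟨t', ht', he⟩ := words_shareRWithMFη S K gbs _ _ hAsc t ht
    exact ⟨t', by simp only [shareRFastMF, List.mem_append]; exact Or.inr (Or.inr ht'), he⟩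

/-- **Hierarchical routing, word-level factor rows, bare packed facts (`J·L` modules), closed through the TREE's semantic
skeleton `energyDensity_ge_of_outroutePSem0`** (`hW` = `words_shareRFastMFη` + `shareRFastMF_perm_lin`; `hsem` =
`polyOp_shareRFastMFη` + `polyOp_perm`): per module `m < J·L` one file
`out_m : PackedNF.pisZero (PackedNF.pcanonNFZHBZ lo hi oP (PackedNF.encP lo hi (shareRFastMFη Sm K (K.gramR.map genBasis) hm
κ₂ J L (m / L) (m % L)))) = true := by native_decide`; hypotheses = `…PMF0`'s + `hAsc` (one `decide`, once). -/
theorem energyDensity_ge_of_outroutePMFη0 {Mo : Type} [DecidableEq Mo] [Hashable Mo] (Sm : MomSpec Mo) (K : SymCertR)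
    (hwf : wellFormed K.expand = true) (hRok : K.gramR.all (gramBlockROK K.frame) = true)
    (hAsc : (K.gramR.all fun B => B.rows.all rowAsc) = true) (oP : PackedNF.PWord → PackedNF.PHint) (hm : MomTable Mo)
    (κ₂ : Word → ℕ) (J L : ℕ) (hJ : 0 < J) (hL : 0 < L) (lo hi : ℤ × ℤ) (hbox : boxLicence K.frame lo hi = true)
    (hcov : coverM Sm K (K.gramR.map genBasis) hm = true)
    (hfacts : OutFactsP0 lo hi oP (fun m => shareRFastMFη Sm K (K.gramR.map genBasis) hm κ₂ J L (m / L) (m % L)) 0 (J * L)) :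
    ((symValueR K : ℚ) : ℝ) ≤ energyDensityTT' 1 0 8 (7 / 8) :=
  energyDensity_ge_of_outroutePSem0 K hwf hRok oP (momKey₂ Sm hm κ₂ J L) (J * L) (Nat.mul_pos hJ hL) _
    (fun m _ t ht => by
      obtain ⟨t', ht', he⟩ := words_shareRFastMFη Sm K _ hm κ₂ J L _ _ (rowsAsc_of_all K hAsc) t ht
      exact ⟨t', (shareRFastMF_perm_lin Sm K hm κ₂ hJ hL hcov m).mem_iff.1 ht', he⟩)
    (fun Λ' m _ => by
      rw [polyOp_shareRFastMFη Sm K _ hm κ₂ J L _ _ (rowsAsc_of_all K hAsc) Λ']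
      exact polyOp_perm Λ' (shareRFastMF_perm_lin Sm K hm κ₂ hJ hL hcov m))
    lo hi hbox hfacts


end Eta

end Summit.Ventures.CertifiedManyBodySolver.Theorems.SymReplay
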